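import Summits.MatrixMultiplication.OmegaCensus.STPPZoo313Checker
import Summits.MatrixMultiplication.OmegaCensus.STPPZoo313TableP4

/-!
# ω-census (abelian STPP census): certification rows of the (3,13)@61 two-above zoo — leaf ranges, part 35

HONEST FRAMING (pub-omega census; verbatim): lottery ticket; floor = certified bounds/negative ranges.
Census STRUCTURE (seat pub-omega-stpp-1 gen 33, 2026-08-29), family (b2).  Kernel rows for `zoo313_61_of_rows` (`STPPZoo313Theorem.lean`): the depth-first
zoo search `zooGo 61 zooTbl61 …` (`STPPZoo313Checker.lean`) split along the prefix tree of the difference sequence; sibling ranges of one node are decided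
in one `decide +kernel` (≤ 15 000 leaves each); node theorems glue their children (`List.range'_append`).  Generator: HOME
`pub-omega-stpp-1-g33/code/gen_zoo_rows.py`.  Nothing here is progress on `ω`.
-/

namespace Summit.MatrixMultiplication.OmegaCensus.CubeNB.S2

/-- Zoo rows: node [1, 1, 1], children d ∈ [22, 22] (9309 leaves). [folklore] -/
theorem zooRow_r1_1_1_22_1 : ((List.range' 22 1).all fun d => cond (Nat.ble 2 d) (Nat.beq 3 0 || zooGo 61 zooTbl61 8 (56 - d) (3 - 1) (3 + d) (15 ||| (1 <<< (3 + d))) ((3 + d) :: [3, 2, 1, 0])) (zooGo 61 zooTbl61 8 (56 - d) 3 (3 + d) (15 ||| (1 <<< (3 + d))) ((3 + d) :: [3, 2, 1, 0]))) = true := by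
  decide +kernel

/-- Zoo rows: node [1, 1, 1], children d ∈ [23, 23] (8601 leaves). [folklore] -/
theorem zooRow_r1_1_1_23_1 : ((List.range' 23 1).all fun d => cond (Nat.ble 2 d) (Nat.beq 3 0 || zooGo 61 zooTbl61 8 (56 - d) (3 - 1) (3 + d) (15 ||| (1 <<< (3 + d))) ((3 + d) :: [3, 2, 1, 0])) (zooGo 61 zooTbl61 8 (56 - d) 3 (3 + d) (15 ||| (1 <<< (3 + d))) ((3 + d) :: [3, 2, 1, 0]))) = true := by
  decide +kernel

/-- Zoo rows: node [1, 1, 1], children d ∈ [24, 24] (7921 leaves). [folklore] -/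
theorem zooRow_r1_1_1_24_1 : ((List.range' 24 1).all fun d => cond (Nat.ble 2 d) (Nat.beq 3 0 || zooGo 61 zooTbl61 8 (56 - d) (3 - 1) (3 + d) (15 ||| (1 <<< (3 + d))) ((3 + d) :: [3, 2, 1, 0])) (zooGo 61 zooTbl61 8 (56 - d) 3 (3 + d) (15 ||| (1 <<< (3 + d))) ((3 + d) :: [3, 2, 1, 0]))) = true := by
  decide +kernel

/-- Zoo rows: node [1, 1, 1], children d ∈ [25, 26] (13914 leaves). [folklore] -/
theorem zooRow_r1_1_1_25_2 : ((List.range' 25 2).all fun d => cond (Nat.ble 2 d) (Nat.beq 3 0 || zooGo 61 zooTbl61 8 (56 - d) (3 - 1) (3 + d) (15 ||| (1 <<< (3 + d))) ((3 + d) :: [3, 2, 1, 0])) (zooGo 61 zooTbl61 8 (56 - d) 3 (3 + d) (15 ||| (1 <<< (3 + d))) ((3 + d) :: [3, 2, 1, 0]))) = true := by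
  decide +kernel

end Summit.MatrixMultiplication.OmegaCensus.CubeNB.S2
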